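import Summits.CriticalPhenomena.PercolationContinuityZ3.Theorems.PercAnnulusCrossingMetricToBoxRendering
import Summits.CriticalPhenomena.PercolationContinuityZ3.Theorems.PercAnnulusCrossingSetToSetQuasiMultAllScales
import Summits.CriticalPhenomena.PercolationContinuityZ3.Theorems.PercAnnulusCrossingOneArmQuasiMultIffDoubling
import Literature.Probability.LatticeModels.ThermodynamicLimit
import HarnessLib

/-!
# Basu–Sapozhnikov's printed (A2) gives one-arm quasi-multiplicativity and doubling on `ℤ^d` (lane RSW3, lead gen 3)

builds on p205010 (kernel theorem, internal audit signed; external expert review pending)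

RSW3 lane (LANE 3 `prim-rsw3`), lead seat, gen 3.  Helper file (`--supports`); no definitions, no sorries; does not use
p205010.  Gen 3's `oneArmQuasiMultAt_of_setToSetQuasiMultAt` derived the lane's strongest typed (S2) statement — one-arm
quasi-multiplicativity uniform in the aspect ratio, `Crossing.OneArmQuasiMultAt` — from (A2) in box form at the Basu–Sapozhnikov
aspect `(2,4)`.  Here the same at a GENERAL aspect `(s, L)`, `2 ≤ s ≤ L` (defs v5 `Crossing.SetToSetQuasiMultAspectAt`), and hence —
through the one-way rendering theorem `setToSetQuasiMultAspectAt_of_basuSapozhnikovQM` (aspect `(4d, 16d²)`) — from the PRINTED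
graph-metric hypothesis:

* `oneArmProb_quasiMult_of_setToSetQuasiMultAspectAt` — every `p`: (A2)□ at aspect `(s,L)` (`1 ≤ s ≤ L`) ⇒
  `ϰ · π_p(sm) · P_p(Λ(sm) ↔ ∂ⁱⁿΛ(N) in Λ(N)) ≤ π_p(N)` for all `m ≥ 1`, `N > Lm` (instance `Z = Λ(N)`, `X = {0}`, `Y = ∂ⁱⁿΛ(N)`);
* `oneArmQuasiMultAt_of_setToSetQuasiMultAspectAt` — at `p_c(ℤ^d)`, `d ≥ 2`, `2 ≤ s ≤ L`, `ϰ > 0`: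
  `SetToSetQuasiMultAspectAt d p_c s L ϰ → ∃ c > 0, OneArmQuasiMultAt d p_c c` (far scales by the previous item at `m = ⌈n/s⌉`
  with supermultiplicativity `π(n)π(s−1) ≤ 2d·π(sm)`; near scales `N ≤ Lm` by `π(Lm+1) ≥ ϰ·w·π(sm)`, `w` the every-aspect window);
* **`oneArmQuasiMultAt_of_basuSapozhnikovQM`**, **`oneArmDoublingAt_of_basuSapozhnikovQM`** — at `p_c(ℤ^d)`, `d ≥ 2`: Basu–Sapozhnikov's
  PRINTED (A2) (`BasuSapozhnikovQM (zdGraph d) 0 p_c ϰ`, `ϰ > 0`) implies one-arm quasi-multiplicativity over all scale pairs and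
  one-arm doubling `π_{p_c}(2n) ≥ c·π_{p_c}(n)`.

So the open input of the printed IIC construction, in the authors' own formulation, already has kernel consequences on `ℤ^d`
that the census measures (one-arm doubling constant `D ≈ 0.72`, gluing constants `c*(x) ≈ 0.5–0.34`, CENSUS-QM).
[cite: BasuSapozhnikov2017ECP, §1 assumption (A2)] [cite: Kesten1982, Cor. 5.1] [cite: Grimmett1999, §1.4]
-/

noncomputable section

namespace Summit.CriticalPhenomena.PercolationContinuityZ3.Theorems.Crossing

open MeasureTheory Literature.Probability.Percolation Literature.Probability.LatticeModels
open Literature.Probability.Percolation.DCT16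
open Summit.CriticalPhenomena.PercolationContinuityZ3.Theorems.SurfaceTension

variable {d : ℕ}

/-- **Far-scale one-arm quasi-multiplicativity from (A2)□ at aspect `(s, L)`** (every `p`, `1 ≤ s ≤ L`): for `m ≥ 1` and `N > Lm`,
`ϰ · π_p(sm) · P_p(Λ(sm) ↔ ∂ⁱⁿΛ(N) in Λ(N)) ≤ π_p(N)` — the instance `Z = Λ(N)`, `X = {0}`, `Y = ∂ⁱⁿΛ(N)`.
[cite: BasuSapozhnikov2017ECP, §1 assumption (A2)] -/
theorem oneArmProb_quasiMult_of_setToSetQuasiMultAspectAt (p : unitInterval) {s L : ℕ} {ϰ : ℝ} (hs : 1 ≤ s) (hsL : s ≤ L)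
    (h : SetToSetQuasiMultAspectAt d p s L ϰ) {m N : ℕ} (hm : 1 ≤ m) (hN : L * m < N) :
    ϰ * (oneArmProb d p (s * m) * (bondPercolation (zdGraph d) p).real (boxCrossing d (s * m) N)) ≤ oneArmProb d p N := by
  set μ := bondPercolation (zdGraph d) p with hμ
  by_cases hϰ : ϰ ≤ 0
  · exact (mul_nonpos_of_nonpos_of_nonneg hϰ (mul_nonneg measureReal_nonneg measureReal_nonneg)).trans measureReal_nonneg
  push Not at hϰ
  have hsm1 : 1 ≤ s * m := by nlinarith
  have hsmN : s * m ≤ N := by nlinarith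
  have hZ : box d (L * m) \ box d (m - 1) ⊆ box d N := fun z hz => box_mono d hN.le (Finset.mem_sdiff.1 hz).1
  have hX : ({(0 : Site d)} : Finset (Site d)) ⊆ box d N ∩ box d m := by
    rw [Finset.singleton_subset_iff, Finset.mem_inter]
    exact ⟨zero_mem_box d N, zero_mem_box d m⟩
  have hY : innerBoundary (zdGraph d) (box d N) ⊆ box d N \ box d (L * m) := by
    intro y hy
    refine Finset.mem_sdiff.2 ⟨(mem_innerBoundary_iff.1 hy).1, fun hy' => ?_⟩
    obtain ⟨i, hi⟩ := exists_eq_of_mem_innerBoundary_box hy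
    have h1 := (mem_box.1 hy') i
    rcases hi with hi | hi <;> rw [hi] at h1 <;> push_cast at h1 <;> omega
  have hA2 := h m hm (box d N) hZ {0} hX (innerBoundary (zdGraph d) (box d N)) hY
  -- `A ≥ π(sm)`
  have hA : oneArmProb d p (s * m) ≤ μ.real {ω | ∃ x ∈ ({(0 : Site d)} : Finset (Site d)),
      ∃ t ∈ innerBoundary (zdGraph d) (box d (s * m)), ω ∈ openConnIn (↑(box d N) : Set (Site d)) x t} := by
    refine measureReal_mono (fun ω hω => ?_) (measure_ne_top μ _)
    obtain ⟨t, ht, hωt⟩ := hω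
    exact ⟨0, Finset.mem_singleton_self 0, t, ht,
      openConnIn_mono (Finset.coe_subset.2 (box_mono d hsmN)) _ _ hωt⟩
  -- `B ≥ P(Λ(sm) ↔ ∂ⁱⁿΛ(N))`
  have hB : μ.real (boxCrossing d (s * m) N) ≤ μ.real {ω | ∃ y ∈ innerBoundary (zdGraph d) (box d N),
      ∃ t ∈ innerBoundary (zdGraph d) (box d (s * m)), ω ∈ openConnIn (↑(box d N) : Set (Site d)) y t} :=
    real_boxCrossing_le_real_link_spheres_of_le p hsm1 hsmN (fun z hz => (Finset.mem_sdiff.1 hz).1)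
  -- `C ≤ π(N)`
  have hC : μ.real {ω | ∃ x ∈ ({(0 : Site d)} : Finset (Site d)), ∃ y ∈ innerBoundary (zdGraph d) (box d N),
      ω ∈ openConnIn (↑(box d N) : Set (Site d)) x y} ≤ oneArmProb d p N := by
    refine measureReal_mono (fun ω hω => ?_) (measure_ne_top μ _)
    obtain ⟨x, hx, y, hy, hxy⟩ := hω
    rw [Finset.mem_singleton] at hx
    subst hx
    exact ⟨y, hy, hxy⟩
  calc ϰ * (oneArmProb d p (s * m) * μ.real (boxCrossing d (s * m) N))
      ≤ ϰ * (μ.real {ω | ∃ x ∈ ({(0 : Site d)} : Finset (Site d)),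
            ∃ t ∈ innerBoundary (zdGraph d) (box d (s * m)), ω ∈ openConnIn (↑(box d N) : Set (Site d)) x t} *
          μ.real {ω | ∃ y ∈ innerBoundary (zdGraph d) (box d N),
            ∃ t ∈ innerBoundary (zdGraph d) (box d (s * m)), ω ∈ openConnIn (↑(box d N) : Set (Site d)) y t}) :=
        mul_le_mul_of_nonneg_left (mul_le_mul hA hB measureReal_nonneg measureReal_nonneg) hϰ.le
    _ ≤ μ.real {ω | ∃ x ∈ ({(0 : Site d)} : Finset (Site d)), ∃ y ∈ innerBoundary (zdGraph d) (box d N),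
          ω ∈ openConnIn (↑(box d N) : Set (Site d)) x y} := hA2
    _ ≤ oneArmProb d p N := hC

/-- **(A2)□ at aspect `(s, L)` at `p_c(ℤ^d)` ⇒ one-arm quasi-multiplicativity over ALL scale pairs** (`d ≥ 2`, `2 ≤ s ≤ L`, `ϰ > 0`):
`SetToSetQuasiMultAspectAt d p_c s L ϰ → ∃ c > 0, OneArmQuasiMultAt d p_c c`, with
`c = ϰ · w · π_{p_c}(s−1)/(2d)`, `w = (2d)⁻¹ (s/(4(L+1)))^{d−1}` the every-aspect window.
[cite: BasuSapozhnikov2017ECP, §1 assumption (A2)] [cite: Kesten1982, Cor. 5.1] -/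
theorem oneArmQuasiMultAt_of_setToSetQuasiMultAspectAt (hd : 2 ≤ d) {s L : ℕ} (hs : 2 ≤ s) (hsL : s ≤ L) {ϰ : ℝ}
    (hϰ : 0 < ϰ) (h : SetToSetQuasiMultAspectAt d (criticalProbI d) s L ϰ) :
    ∃ c : ℝ, 0 < c ∧ OneArmQuasiMultAt d (criticalProbI d) c := by
  have hd0 : 0 < d := by omega
  set μ := bondPercolation (zdGraph d) (criticalProbI d) with hμ
  set π : ℕ → ℝ := fun n => oneArmProb d (criticalProbI d) n with hπ
  -- the floor `π(s-1) > 0`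
  obtain ⟨c₀, hc₀, hfloor⟩ := exists_oneArmProb_criticalProbI_lower_half hd
  have hπs : 0 < π (s - 1) := by
    have h1 := hfloor (s - 1) (by omega)
    have h2 : 0 < c₀ / ((s - 1 : ℕ) : ℝ) ^ (((d : ℝ) - 1) / 2) := by
      have : (0 : ℝ) < ((s - 1 : ℕ) : ℝ) := by exact_mod_cast (by omega : 0 < s - 1)
      positivity
    exact h2.trans_le h1
  -- the window at aspect `(s, L)`
  set w : ℝ := (2 * (d : ℝ))⁻¹ * ((s : ℝ) / (4 * ((L : ℝ) + 1))) ^ (d - 1) with hw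
  have hwpos : 0 < w := by positivity
  have hw1 : w ≤ 1 := by
    have hd2 : (2 : ℝ) ≤ d := by exact_mod_cast hd
    have h1 : (2 * (d : ℝ))⁻¹ ≤ 1 := inv_le_one_of_one_le₀ (by linarith)
    have h2 : ((s : ℝ) / (4 * ((L : ℝ) + 1))) ^ (d - 1) ≤ 1 := by
      apply pow_le_one₀ (by positivity)
      rw [div_le_one (by positivity)]
      have : (s : ℝ) ≤ L := by exact_mod_cast hsL
      linarith
    calc w = (2 * (d : ℝ))⁻¹ * ((s : ℝ) / (4 * ((L : ℝ) + 1))) ^ (d - 1) := hw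
      _ ≤ 1 * 1 := mul_le_mul h1 h2 (by positivity) zero_le_one
      _ = 1 := one_mul 1
  have hwin : ∀ m : ℕ, 1 ≤ m → w ≤ μ.real (boxCrossing d (s * m) (L * m + 1)) := by
    intro m hm
    have hsm1 : 1 ≤ s * m := by nlinarith
    have hle : s * m ≤ L * m + 1 := by nlinarith
    have hK := Rsw3.le_real_boxCrossing_criticalProbI_of_le hd hsm1 hle
    refine le_trans ?_ hK
    rw [hw]
    apply mul_le_mul_of_nonneg_left _ (by positivity)
    apply pow_le_pow_left₀ (by positivity)
    rw [div_le_div_iff₀ (by positivity) (by positivity)]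
    push_cast
    have hm' : (1 : ℝ) ≤ m := by exact_mod_cast hm
    have hs' : (0 : ℝ) ≤ s := by positivity
    have hL' : (0 : ℝ) ≤ L := by positivity
    nlinarith [mul_nonneg hs' hL', mul_nonneg hs' (sub_nonneg.2 hm')]
  -- supermultiplicativity: `π(s-1)/(2d) · π(n) ≤ π(s ⌈n/s⌉)`
  have hceil : ∀ n : ℕ, 1 ≤ n → π (s - 1) / (2 * d) * π n ≤ π (s * ((n + s - 1) / s)) := by
    intro n hn
    have h1 : s * ((n + s - 1) / s) ≤ n + (s - 1) := by
      have := Nat.div_mul_le_self (n + s - 1) s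
      rw [Nat.mul_comm] at this
      omega
    have hanti : π (n + (s - 1)) ≤ π (s * ((n + s - 1) / s)) := real_siteToBoundary_antitone (criticalProbI d) h1
    have hsuper := RSW3.oneArmProb_mul_le hd0 (criticalProbI d) n (s - 1)
    have hdR : (0 : ℝ) < 2 * d := by positivity
    rw [div_mul_eq_mul_div, div_le_iff₀ hdR]
    have : π n * π (s - 1) ≤ 2 * (d : ℝ) * π (n + (s - 1)) := hsuper
    nlinarith [hanti]
  -- the constant
  refine ⟨ϰ * w * (π (s - 1) / (2 * d)), by positivity, fun n N hn hnN => ?_⟩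
  set m : ℕ := (n + s - 1) / s with hm
  have hm1 : 1 ≤ m := by
    rw [hm]; exact (Nat.le_div_iff_mul_le (by omega)).2 (by omega)
  have hnsm : n ≤ s * m := by
    rw [hm]
    have h1 := Nat.div_add_mod (n + s - 1) s
    have h2 := Nat.mod_lt (n + s - 1) (show 0 < s by omega)
    omega
  have hπn0 : 0 ≤ π n := measureReal_nonneg
  have hπsm := hceil n hn
  have hα0 : 0 ≤ μ.real (boxCrossing d n N) := measureReal_nonneg
  have hα1 : μ.real (boxCrossing d n N) ≤ 1 := measureReal_le_one
  by_cases hfar : L * m < N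
  · -- far scales
    have hstep := oneArmProb_quasiMult_of_setToSetQuasiMultAspectAt (criticalProbI d) (by omega) hsL h hm1 hfar
    have hαmono : μ.real (boxCrossing d n N) ≤ μ.real (boxCrossing d (s * m) N) :=
      measureReal_mono (boxCrossing_mono_left hnsm N) (measure_ne_top μ _)
    have hπsm0 : 0 ≤ π (s * m) := measureReal_nonneg
    calc ϰ * w * (π (s - 1) / (2 * d)) * (oneArmProb d (criticalProbI d) n * μ.real (boxCrossing d n N))
        ≤ ϰ * 1 * (π (s - 1) / (2 * d)) * (π n * μ.real (boxCrossing d n N)) := by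
          apply mul_le_mul_of_nonneg_right _ (mul_nonneg hπn0 hα0)
          exact mul_le_mul_of_nonneg_right (mul_le_mul_of_nonneg_left hw1 hϰ.le) (by positivity)
      _ = ϰ * ((π (s - 1) / (2 * d) * π n) * μ.real (boxCrossing d n N)) := by ring
      _ ≤ ϰ * (π (s * m) * μ.real (boxCrossing d (s * m) N)) :=
          mul_le_mul_of_nonneg_left (mul_le_mul hπsm hαmono hα0 hπsm0) hϰ.le
      _ ≤ oneArmProb d (criticalProbI d) N := hstep
  · -- near scales: `N ≤ L m < L m + 1`
    push Not at hfar
    have hstep := oneArmProb_quasiMult_of_setToSetQuasiMultAspectAt (criticalProbI d) (by omega) hsL h hm1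
      (lt_add_one (L * m))
    have hwm := hwin m hm1
    have hanti : π (L * m + 1) ≤ π N := real_siteToBoundary_antitone (criticalProbI d) (by omega)
    have hπsm0 : 0 ≤ π (s * m) := measureReal_nonneg
    calc ϰ * w * (π (s - 1) / (2 * d)) * (oneArmProb d (criticalProbI d) n * μ.real (boxCrossing d n N))
        ≤ ϰ * w * (π (s - 1) / (2 * d)) * (π n * 1) := by
          apply mul_le_mul_of_nonneg_left (mul_le_mul_of_nonneg_left hα1 hπn0) (by positivity)
      _ = ϰ * ((π (s - 1) / (2 * d) * π n) * w) := by ring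
      _ ≤ ϰ * (π (s * m) * μ.real (boxCrossing d (s * m) (L * m + 1))) :=
          mul_le_mul_of_nonneg_left (mul_le_mul hπsm hwm hwpos.le hπsm0) hϰ.le
      _ ≤ π (L * m + 1) := hstep
      _ ≤ oneArmProb d (criticalProbI d) N := hanti

/-- **Basu–Sapozhnikov's PRINTED (A2) at `p_c(ℤ^d)` ⇒ one-arm quasi-multiplicativity over all scale pairs** (`d ≥ 2`, `ϰ > 0`):
`BasuSapozhnikovQM (zdGraph d) 0 p_c ϰ → ∃ c > 0, OneArmQuasiMultAt d p_c c` (one-way rendering at aspect `(4d, 16d²)` + the previous theorem).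
[cite: BasuSapozhnikov2017ECP, §1 assumption (A2)] -/
theorem oneArmQuasiMultAt_of_basuSapozhnikovQM (hd : 2 ≤ d) {ϰ : ℝ} (hϰ : 0 < ϰ)
    (hBS : BasuSapozhnikovQM (zdGraph d) (0 : Site d) (criticalProbI d) ϰ) :
    ∃ c : ℝ, 0 < c ∧ OneArmQuasiMultAt d (criticalProbI d) c := by
  have hbox := setToSetQuasiMultAspectAt_of_basuSapozhnikovQM hd hϰ.le hBS
  have hdpos : (0 : ℝ) < d := by exact_mod_cast (by omega : 0 < d)
  have h4d : (0 : ℝ) < ((4 * d : ℕ) : ℝ) := by exact_mod_cast (by omega : 0 < 4 * d)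
  refine oneArmQuasiMultAt_of_setToSetQuasiMultAspectAt hd (s := 4 * d) (L := 4 * d * (4 * d)) (by omega)
    (by nlinarith) ?_ hbox
  positivity

/-- **Basu–Sapozhnikov's PRINTED (A2) at `p_c(ℤ^d)` ⇒ one-arm doubling** (`d ≥ 2`, `ϰ > 0`):
`BasuSapozhnikovQM (zdGraph d) 0 p_c ϰ → ∃ c > 0, OneArmDoublingAt d p_c c`, i.e. `π_{p_c}(2n) ≥ c·π_{p_c}(n)` for all `n ≥ 1`.
[cite: BasuSapozhnikov2017ECP, §1 assumption (A2)] [cite: Kesten1982, Cor. 5.1] -/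
theorem oneArmDoublingAt_of_basuSapozhnikovQM (hd : 2 ≤ d) {ϰ : ℝ} (hϰ : 0 < ϰ)
    (hBS : BasuSapozhnikovQM (zdGraph d) (0 : Site d) (criticalProbI d) ϰ) :
    ∃ c : ℝ, 0 < c ∧ OneArmDoublingAt d (criticalProbI d) c := by
  obtain ⟨c, hc, hqm⟩ := oneArmQuasiMultAt_of_basuSapozhnikovQM hd hϰ hBS
  exact ⟨c * ((85 : ℝ) ^ d)⁻¹, by positivity, oneArmDoublingAt_of_oneArmQuasiMultAt hd hc.le hqm⟩

/-- **On `ℤ³`: Basu–Sapozhnikov's PRINTED (A2) at `p_c(ℤ³)` (`ϰ > 0`) implies the lane's (S2′) `Crossing.OneArmDoubling`**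
(`∃ c > 0, π_{p_c}(2n) ≥ c·π_{p_c}(n)`), and one-arm quasi-multiplicativity over all scale pairs — so the single open input of
the printed IIC construction for `ℤ³`, in the authors' own graph-metric form, sits ABOVE the lane's typed (S2)/(S2′) statements
(kernel; appended lead gen 3). [cite: BasuSapozhnikov2017ECP, §1 assumption (A2) and Thm. 1.1] -/
theorem oneArmDoubling_of_basuSapozhnikovQM_zd3 {ϰ : ℝ} (hϰ : 0 < ϰ)
    (hBS : BasuSapozhnikovQM (zdGraph 3) (0 : Site 3) (criticalProbI 3) ϰ) : OneArmDoubling := by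
  obtain ⟨c, hc, hqm⟩ := oneArmQuasiMultAt_of_basuSapozhnikovQM (d := 3) (by norm_num) hϰ hBS
  exact oneArmDoubling_of_oneArmQuasiMultAt hc hqm

end Summit.CriticalPhenomena.PercolationContinuityZ3.Theorems.Crossing

end
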